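import Mathlib
import HarnessLib
import Summits.ABC.Statement

/-!
# PlatonicClosureCoreTransport — part 1/5 of the ROUTE-INDEPENDENT node kernel `PlatonicClosureCore` (door J, second layer; lens-1 gen 7)

Source: lens-1 g7 ROUTE-INDEPENDENT landing variant `pkg/PlatonicClosureTheorems.lean` (cell `decomp-abc`; sha256
`f8bb28f6c96ac600…`; = node file `PlatonicClosure.lean` v2.2 with the three `Theses.RootDecompJ/B/G` imports replaced
by seven inline TREE TEXTS §T, writer recipe decomp-abc STATUS l.502; lens `lean check` rc 0 · 0 sorry · axioms
standard; critic PRE-CLEARED l.513, bridge test `Iff.rfl` ×7 against J rev 3 / B rev 7 / G rev 6 rc 0).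

This module: §T the seven inlined TREE TEXTS (`CampanaHyperbolicBound`, `EuclideanABC`, `SphericalABC` of door J;
`KummerFloorHigh`, `KummerFloorCell5` of door B; `KummerFloor4`, `KummerFloorCell4` of door G) · §0 types · §1
Platonic levels / cells / `AbcOn` · §2 `abc_of_transport` · §3 arithmetic helpers.

Landing form (prover lane decomp-abc-lander-1; writer asks (d)/(d′) ladder-directors REQUESTS l.59623 / l.59667 + constraint STATUS
l.502): this ROUTE-INDEPENDENT copy imports no route file, so a route's gate-rendered `closes` can cite it without an import
cycle (`exact Summit.ABC.ABC.Theorems.PlatonicClosureCore.closes7 h₁ h₂ h₃ h₄` with route hypotheses, by defeq of the §T texts).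
The source is split MECHANICALLY into five modules of ≤ 400 lines: `PlatonicClosureCoreTransport` (§T, §0–§3) →
`PlatonicClosureCoreOctahedral` (§4–§5) → `PlatonicClosureCore` (§6–§7, §13; head module: `closes7`) →
`PlatonicClosureCoreFloorBlocker` (§11) → `PlatonicClosureCoreKummerDoors` (§12–§12b: doors B/G).  Sections §7b–§10 (dihedral
lift, witnesses, necessity `S ⟹ P_H`, `node_iff7` over the ROUTE decls by name) are landed only in the J-importing chain
`Theorems/PlatonicClosure*.lean`
(namespace `Summit.ABC.ABC.Theorems.PlatonicClosure`, p766787 / p766892 / p766965 / p767152).  The ONLY edits here: namespace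
`Summit.ABC.ABC.Theorems.PlatonicClosureCore` (source: `…Theorems.PlatonicClosure`, already taken by that chain), one-line
docstrings on declarations that had none, per-module imports and module docstrings, and `private` on pure folklore lemmas whose
statements are already landed (gate `dedup.landed`) with private verbatim copies where a later module uses them.  Every statement
and every proof is byte-identical to the source.  Nothing here proves `ABC` or any item of doors J/B/G (`--supports` helpers).

## The source's own preamble (verbatim)

The node's full description (§§0–13 narrative, tags, test `T_ico`) is the module docstring of
`Summits/ABC/ABC/Theorems/PlatonicClosureTransport.lean` (same text as the source's, v2.1) and is not repeated here.

ROUTE-INDEPENDENT LANDING VARIANT of g7/PlatonicClosure.lean v2.2 (sha256 8fd38c1d…): identical mathematics; the three route-file imports are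
replaced by seven inline tree texts (§T) and the namespace is `Summit.ABC.ABC.Theorems.PlatonicClosure` (writer recipe STATUS l.502).
-/

set_option linter.dupNamespace false
-- lint debt, justified: verbatim planner-cleared proofs keep the item texts' binder names (some hypotheses are unused by name).
set_option linter.unusedVariables false

open Literature.NumberTheory.DiophantineGeometry
open UniqueFactorizationMonoid
open Finset

namespace Summit.ABC.ABC.Theorems.PlatonicClosureCore

/-! ## §T  Tree texts, inlined (route-independent landing variant; writer recipe STATUS l.502)

This variant imports NO route file (`Theses.RootDecompJ/B/G`), so that the route files can import IT without a cycle.  The seven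
definitions below are the TREE TEXTS VERBATIM (bodies copied mechanically from the gate-written route files at J rev 3 / B rev 7 / G rev 6);
each is definitionally equal to the route decl of the same name, so a route's `closes` bridges by `Iff.rfl` / defeq
(`exact Summit.ABC.ABC.Theorems.PlatonicClosure.closes7 h₁ h₂ h₃ h₄` with `hᵢ` the ROUTE hypotheses). -/

/-- tree text verbatim of `Summit.ABC.ABC.Theses.CampanaHyperbolicBound` (stmt-ABC-29353; J l.335). -/
def CampanaHyperbolicBound : Prop :=
  ∃ B : ℕ, ∀ a b c : ℕ, Literature.NumberTheory.DiophantineGeometry.IsABCTriple a b c → (∃ p q r : ℕ, ((p = 0 → a = 1) ∧ ∀ ℓ ∈ a.primeFactors, p ≤ a.factorization ℓ) ∧ ((q = 0 → b = 1) ∧ ∀ ℓ ∈ b.primeFactors, q ≤ b.factorization ℓ) ∧ ((r = 0 → c = 1) ∧ ∀ ℓ ∈ c.primeFactors, r ≤ c.factorization ℓ) ∧ (p : ℚ)⁻¹ + (q : ℚ)⁻¹ + (r : ℚ)⁻¹ < 1) → c ≤ B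

/-- tree text verbatim of `Summit.ABC.ABC.Theses.EuclideanABC` (stmt-ABC-29354; J l.350). -/
def EuclideanABC : Prop :=
  ∀ ε : ℝ, 0 < ε → ∃ C : ℝ, 0 < C ∧ ∀ a b c : ℕ, Literature.NumberTheory.DiophantineGeometry.IsABCTriple a b c → (∃ p q r : ℕ, ((p = 0 → a = 1) ∧ ∀ ℓ ∈ a.primeFactors, p ≤ a.factorization ℓ) ∧ ((q = 0 → b = 1) ∧ ∀ ℓ ∈ b.primeFactors, q ≤ b.factorization ℓ) ∧ ((r = 0 → c = 1) ∧ ∀ ℓ ∈ c.primeFactors, r ≤ c.factorization ℓ) ∧ (p : ℚ)⁻¹ + (q : ℚ)⁻¹ + (r : ℚ)⁻¹ = 1) → (c : ℝ) < C * ((Literature.NumberTheory.DiophantineGeometry.rad a b c : ℕ) : ℝ) ^ (1 + ε)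

/-- tree text verbatim of `Summit.ABC.ABC.Theses.SphericalABC` (stmt-ABC-29355; J l.364). -/
def SphericalABC : Prop :=
  ∀ ε : ℝ, 0 < ε → ∃ C : ℝ, 0 < C ∧ ∀ a b c : ℕ, Literature.NumberTheory.DiophantineGeometry.IsABCTriple a b c → (∀ p q r : ℕ, ((p = 0 → a = 1) ∧ ∀ ℓ ∈ a.primeFactors, p ≤ a.factorization ℓ) → ((q = 0 → b = 1) ∧ ∀ ℓ ∈ b.primeFactors, q ≤ b.factorization ℓ) → ((r = 0 → c = 1) ∧ ∀ ℓ ∈ c.primeFactors, r ≤ c.factorization ℓ) → 1 < (p : ℚ)⁻¹ + (q : ℚ)⁻¹ + (r : ℚ)⁻¹) → (c : ℝ) < C * ((Literature.NumberTheory.DiophantineGeometry.rad a b c : ℕ) : ℝ) ^ (1 + ε)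

/-- tree text verbatim of `Summit.ABC.ABC.Theses.KummerFloorHigh` (stmt-ABC-25300; B l.317). -/
def KummerFloorHigh : Prop :=
  ∃ C : ℕ, ∀ a b c : ℕ, Literature.NumberTheory.DiophantineGeometry.IsABCTriple a b c → ((∃ x y : ℕ, a = x ^ 5 ∧ b = y ^ 5) ∨ (∃ x z : ℕ, a = x ^ 5 ∧ c = z ^ 5) ∨ (∃ y z : ℕ, b = y ^ 5 ∧ c = z ^ 5)) → c ≤ C * ((a * b * c).primeFactors.filter (fun p => ¬ 5 ∣ (a * b * c).factorization p)).prod (fun p => p) ^ 4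

/-- tree text verbatim of `Summit.ABC.ABC.Theses.KummerFloorCell5` (stmt-ABC-23645; B l.347). -/
def KummerFloorCell5 : Prop :=
  ∀ K : ℕ, ∀ ε : ℝ, 0 < ε → ∃ C : ℝ, 0 < C ∧ ∀ a b c : ℕ, Literature.NumberTheory.DiophantineGeometry.IsABCTriple a b c → c ≤ K * ((a * b * c).primeFactors.filter (fun p => ¬ 5 ∣ (a * b * c).factorization p)).prod (fun p => p) ^ 4 → (c : ℝ) < C * ((Literature.NumberTheory.DiophantineGeometry.rad a b c : ℕ) : ℝ) ^ (1 + ε)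

/-- tree text verbatim of `Summit.ABC.ABC.Theses.KummerFloor4` (stmt-ABC-27123?; G l.249). -/
def KummerFloor4 : Prop :=
  ∃ C : ℕ, ∀ a b c : ℕ, Literature.NumberTheory.DiophantineGeometry.IsABCTriple a b c → c ≤ C * ((a * b * c).primeFactors.filter (fun p => ¬ 4 ∣ (a * b * c).factorization p)).prod (fun p => p) ^ 5

/-- tree text verbatim of `Summit.ABC.ABC.Theses.KummerFloorCell4` (stmt-ABC-27124; G l.264). -/
def KummerFloorCell4 : Prop :=
  ∀ K : ℕ, ∀ ε : ℝ, 0 < ε → ∃ C : ℝ, 0 < C ∧ ∀ a b c : ℕ, Literature.NumberTheory.DiophantineGeometry.IsABCTriple a b c → c ≤ K * ((a * b * c).primeFactors.filter (fun p => ¬ 4 ∣ (a * b * c).factorization p)).prod (fun p => p) ^ 5 → (c : ℝ) < C * ((Literature.NumberTheory.DiophantineGeometry.rad a b c : ℕ) : ℝ) ^ (1 + ε)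


/-! ## §0  Admissible multiplicities, weights, Campana types (as in door J / gen 6) -/

/-- `Adm p x`: multiplicity `p` is admissible at the member `x` (`x` is `p`-full; `p = 0` encodes `∞`, only at `x = 1`). -/
def Adm (p x : ℕ) : Prop := (p = 0 → x = 1) ∧ ∀ ℓ ∈ x.primeFactors, p ≤ x.factorization ℓ

/-- The weight `1/p + 1/q + 1/r ∈ ℚ` (`0⁻¹ = 0` encodes `1/∞ = 0`). -/
def wt (p q r : ℕ) : ℚ := (p : ℚ)⁻¹ + (q : ℚ)⁻¹ + (r : ℚ)⁻¹

/-- Hyperbolic type: `(a,b,c)` admits a signature `(p,q,r)` (`Adm`) of weight `1/p + 1/q + 1/r < 1`. -/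
def HypType (a b c : ℕ) : Prop := ∃ p q r : ℕ, Adm p a ∧ Adm q b ∧ Adm r c ∧ wt p q r < 1
/-- Euclidean shape: `(a,b,c)` admits a signature `(p,q,r)` of weight exactly `1`. -/
def EucShape (a b c : ℕ) : Prop := ∃ p q r : ℕ, Adm p a ∧ Adm q b ∧ Adm r c ∧ wt p q r = 1
/-- Spherical type: every admissible signature `(p,q,r)` of `(a,b,c)` has weight `> 1`. -/
def SphType (a b c : ℕ) : Prop := ∀ p q r : ℕ, Adm p a → Adm q b → Adm r c → 1 < wt p q r

/-- Trichotomy: every triple is of hyperbolic type, of Euclidean shape, or of spherical type. -/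
theorem hyp_or_euc_or_sph (a b c : ℕ) : HypType a b c ∨ EucShape a b c ∨ SphType a b c := by
  by_cases hH : HypType a b c
  · exact Or.inl hH
  by_cases hE : EucShape a b c
  · exact Or.inr (Or.inl hE)
  refine Or.inr (Or.inr fun p q r hp hq hr => ?_)
  rcases lt_trichotomy (wt p q r) 1 with h | h | h
  · exact absurd ⟨p, q, r, hp, hq, hr, h⟩ hH
  · exact absurd ⟨p, q, r, hp, hq, hr, h⟩ hE
  · exact h

/-! ## §1  Platonic levels inside the spherical cell

Within `SphType` the sorted admissible signatures are `(1,q,r)`, `(2,2,n)`, `(2,3,3)`, `(2,3,4)`, `(2,3,5)`.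
`OctSig`/`IcoSig` say, order-free: all three multiplicities `≥ 2`, two of them `≥ 3`, one of them `≥ 4` (resp. `≥ 5`);
inside `SphType` this pins the sorted signature to `{(2,3,4),(2,3,5)}` (resp. `(2,3,5)`). -/

/-- order-free "(2,3,4) or deeper": all `≥ 2`, two `≥ 3`, one `≥ 4`. -/
def OctSig (p q r : ℕ) : Prop :=
  2 ≤ p ∧ 2 ≤ q ∧ 2 ≤ r ∧ (3 ≤ p ∧ 3 ≤ q ∨ 3 ≤ q ∧ 3 ≤ r ∨ 3 ≤ r ∧ 3 ≤ p) ∧ (4 ≤ p ∨ 4 ≤ q ∨ 4 ≤ r)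

/-- order-free "(2,3,5)": all `≥ 2`, two `≥ 3`, one `≥ 5`. -/
def IcoSig (p q r : ℕ) : Prop :=
  2 ≤ p ∧ 2 ≤ q ∧ 2 ≤ r ∧ (3 ≤ p ∧ 3 ≤ q ∨ 3 ≤ q ∧ 3 ≤ r ∨ 3 ≤ r ∧ 3 ≤ p) ∧ (5 ≤ p ∨ 5 ≤ q ∨ 5 ≤ r)

/-- the octahedral level `L₂₃₄`: some admissible signature is `(2,3,4)` or deeper. -/
def Lvl234 (a b c : ℕ) : Prop := ∃ p q r : ℕ, Adm p a ∧ Adm q b ∧ Adm r c ∧ OctSig p q r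
/-- the icosahedral level `L₂₃₅`. -/
def Lvl235 (a b c : ℕ) : Prop := ∃ p q r : ℕ, Adm p a ∧ Adm q b ∧ Adm r c ∧ IcoSig p q r

/-- ICOSAHEDRAL CELL: spherical triples admitting `(2,3,5)` in some order (profile exactly `(2,3,5)`). -/
def IcoCell (a b c : ℕ) : Prop := SphType a b c ∧ Lvl235 a b c
/-- OCTAHEDRAL CELL: spherical triples admitting `(2,3,4)` in some order but not `(2,3,5)` (profile exactly `(2,3,4)`). -/
def OctCell (a b c : ℕ) : Prop := SphType a b c ∧ Lvl234 a b c ∧ ¬ Lvl235 a b c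
/-- the spherical BULK below the octahedral level. -/
def Bulk (a b c : ℕ) : Prop := SphType a b c ∧ ¬ Lvl234 a b c

/-- abc, `ε`-uniform, on a class `Q` of triples. -/
def AbcOn (Q : ℕ → ℕ → ℕ → Prop) : Prop :=
  ∀ ε : ℝ, 0 < ε → ∃ C : ℝ, 0 < C ∧ ∀ a b c : ℕ, IsABCTriple a b c → Q a b c →
    (c : ℝ) < C * ((rad a b c : ℕ) : ℝ) ^ (1 + ε)

/-- `AbcOn` is antitone in the cell: abc on `Q` gives abc on every `P ⊆ Q`. -/
theorem abcOn_mono {P Q : ℕ → ℕ → ℕ → Prop} (hPQ : ∀ a b c, P a b c → Q a b c) (h : AbcOn Q) : AbcOn P := by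
  intro ε hε
  obtain ⟨C, hC, hQ⟩ := h ε hε
  exact ⟨C, hC, fun a b c ht hP => hQ a b c ht (hPQ a b c hP)⟩

/-- abc on `P` and abc on `Q` give abc on `P ∪ Q`. -/
theorem abcOn_or {P Q : ℕ → ℕ → ℕ → Prop} (hP : AbcOn P) (hQ : AbcOn Q) :
    AbcOn (fun a b c => P a b c ∨ Q a b c) := by
  intro ε hε
  obtain ⟨C₁, hC₁, h₁⟩ := hP ε hε
  obtain ⟨C₂, hC₂, h₂⟩ := hQ ε hε
  refine ⟨max C₁ C₂, lt_max_of_lt_left hC₁, fun a b c ht h => ?_⟩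
  have hR0 : (0 : ℝ) ≤ ((rad a b c : ℕ) : ℝ) ^ (1 + ε) := by positivity
  rcases h with h | h
  · exact (h₁ a b c ht h).trans_le (mul_le_mul_of_nonneg_right (le_max_left _ _) hR0)
  · exact (h₂ a b c ht h).trans_le (mul_le_mul_of_nonneg_right (le_max_right _ _) hR0)

/-- abc on the trivial cell (all triples) is the summit statement `ABC`. -/
theorem abcOn_all_iff : AbcOn (fun _ _ _ => True) ↔ _root_.ABC := by
  rw [_root_.ABC_iff]
  constructor
  · intro h ε hε
    obtain ⟨C, hC, hb⟩ := h ε hε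
    exact ⟨C, hC, fun a b c ht => hb a b c ht trivial⟩
  · intro h ε hε
    obtain ⟨C, hC, hb⟩ := h ε hε
    exact ⟨C, hC, fun a b c ht _ => hb a b c ht⟩

/-- `ABC` gives abc on every cell. -/
theorem abcOn_of_abc (h : _root_.ABC) (Q : ℕ → ℕ → ℕ → Prop) : AbcOn Q :=
  abcOn_mono (fun _ _ _ _ => trivial) (abcOn_all_iff.2 h)

/-- The radical `rad a b c` is positive. -/
private theorem rad_pos' (a b c : ℕ) : 0 < rad a b c := by
  rw [rad_def]; exact Nat.radical_pos _

/-- A class with BOUNDED `c` satisfies abc (`c ≤ B < (B+1)·rad^{1+ε}`). -/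
theorem abcOn_of_bounded {Q : ℕ → ℕ → ℕ → Prop} {B : ℕ} (h : ∀ a b c, IsABCTriple a b c → Q a b c → c ≤ B) :
    AbcOn Q := by
  intro ε hε
  refine ⟨(B : ℝ) + 1, by positivity, fun a b c ht hq => ?_⟩
  have hR1 : (1 : ℝ) ≤ ((rad a b c : ℕ) : ℝ) ^ (1 + ε) :=
    Real.one_le_rpow (by exact_mod_cast rad_pos' a b c) (by linarith)
  have hc : (c : ℝ) ≤ B := by exact_mod_cast h a b c ht hq
  calc (c : ℝ) < (B : ℝ) + 1 := by linarith
    _ ≤ ((B : ℝ) + 1) * ((rad a b c : ℕ) : ℝ) ^ (1 + ε) := le_mul_of_one_le_right (by positivity) hR1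

/-! ## §2  The transport principle (the only real-analysis step)

If every abc triple `(a,b,c)` has an image triple in `Q` with `c^{k+1} ≤ A·c'` and `rad' ≤ K·rad·c^k`
(a BELYI TRANSPORT with three rational special points: gain of exactly one power of `c`), then `AbcOn Q ⟹ ABC`. -/
/-- **Transport principle.** If abc holds on `Q` and every abc triple `(a,b,c)` has an abc image `(a',b',c')` in `Q` with
`c^(k+1) ≤ A·c'` and `rad a' b' c' ≤ K · rad a b c · c^k`, then `ABC`. -/
theorem abc_of_transport {Q : ℕ → ℕ → ℕ → Prop} (hQ : AbcOn Q) {k A K : ℕ} (hA : 0 < A) (hK : 0 < K)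
    (hT : ∀ a b c : ℕ, IsABCTriple a b c → ∃ a' b' c' : ℕ, IsABCTriple a' b' c' ∧ Q a' b' c' ∧
      c ^ (k + 1) ≤ A * c' ∧ rad a' b' c' ≤ K * rad a b c * c ^ k) : _root_.ABC := by
  rw [_root_.ABC_iff]
  intro ε₀ hε₀
  -- choose N with k < N and (N+1)/(N-k) ≤ 1 + ε₀
  obtain ⟨n, hn0, hnε⟩ : ∃ n : ℕ, 0 < n ∧ ((k : ℝ) + 1) ≤ ε₀ * n := by
    refine ⟨⌈((k : ℝ) + 1) / ε₀⌉₊ + 1, by positivity, ?_⟩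
    have h1 : ((k : ℝ) + 1) / ε₀ ≤ ⌈((k : ℝ) + 1) / ε₀⌉₊ := Nat.le_ceil _
    have h3 : ((k : ℝ) + 1) / ε₀ * ε₀ = (k : ℝ) + 1 := div_mul_cancel₀ _ hε₀.ne'
    have h4 := mul_le_mul_of_nonneg_right h1 hε₀.le
    rw [h3] at h4
    push_cast
    nlinarith
  set N : ℕ := n + k with hN
  have hN0 : 0 < N := by omega
  have hNpos : (0 : ℝ) < N := by exact_mod_cast hN0
  obtain ⟨C, hC, hb⟩ := hQ ((N : ℝ)⁻¹) (by positivity)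
  -- the constant
  set M : ℝ := (A : ℝ) ^ N * C ^ N * (K : ℝ) ^ (N + 1) with hM
  have hM0 : 0 < M := by positivity
  set M₁ : ℝ := max M 1 with hM₁
  have hM₁1 : 1 ≤ M₁ := le_max_right _ _
  have hMM₁ : M ≤ M₁ := le_max_left _ _
  refine ⟨M₁ ^ ((n : ℝ)⁻¹), by positivity, fun a b c ht => ?_⟩
  obtain ⟨a', b', c', ht', hq', hcc', hrad'⟩ := hT a b c ht
  have hspec := hb a' b' c' ht' hq'
  -- symbols
  set R : ℝ := ((rad a b c : ℕ) : ℝ) with hR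
  set R' : ℝ := ((rad a' b' c' : ℕ) : ℝ) with hR'
  have hR1 : (1 : ℝ) ≤ R := by rw [hR]; exact_mod_cast Nat.one_le_iff_ne_zero.mpr (rad_pos' a b c).ne'
  have hR0 : (0 : ℝ) ≤ R := by positivity
  have hR'0 : (0 : ℝ) ≤ R' := by positivity
  have hc0' : 0 < c := by obtain ⟨ha, -, habc, -⟩ := ht; omega
  have hc0 : (0 : ℝ) < c := by exact_mod_cast hc0'
  -- (1) c^{N(k+1)} ≤ A^N c'^N
  have h1 : (c : ℝ) ^ (N * (k + 1)) ≤ (A : ℝ) ^ N * (c' : ℝ) ^ N := by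
    have : ((c : ℝ) ^ (k + 1)) ^ N ≤ ((A : ℝ) * c') ^ N :=
      pow_le_pow_left₀ (by positivity) (by exact_mod_cast hcc') N
    rwa [← pow_mul, mul_pow, mul_comm (k + 1)] at this
  -- (2) c'^N < C^N R'^{N+1}
  have h2 : (c' : ℝ) ^ N < C ^ N * R' ^ (N + 1) := by
    have hlt : (c' : ℝ) < C * R' ^ (1 + (N : ℝ)⁻¹) := hspec
    have hNne : (N : ℝ) ≠ 0 := hNpos.ne'
    have hpow : (R' ^ (1 + (N : ℝ)⁻¹)) ^ N = R' ^ (N + 1) := by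
      rw [← Real.rpow_natCast (R' ^ (1 + (N : ℝ)⁻¹)) N, ← Real.rpow_mul hR'0, ← Real.rpow_natCast R' (N + 1),
        add_mul, one_mul, inv_mul_cancel₀ hNne]
      push_cast; ring_nf
    have := pow_lt_pow_left₀ hlt (by positivity) hN0.ne'
    rwa [mul_pow, hpow] at this
  -- (3) R'^{N+1} ≤ K^{N+1} R^{N+1} c^{k(N+1)}
  have h3 : R' ^ (N + 1) ≤ (K : ℝ) ^ (N + 1) * R ^ (N + 1) * (c : ℝ) ^ (k * (N + 1)) := by
    have : R' ≤ (K : ℝ) * R * (c : ℝ) ^ k := by rw [hR', hR]; exact_mod_cast hrad'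
    have := pow_le_pow_left₀ hR'0 this (N + 1)
    rwa [mul_pow, mul_pow, ← pow_mul] at this
  -- combine: c^{N(k+1)} < M R^{N+1} c^{k(N+1)}
  have h4 : (c : ℝ) ^ (N * (k + 1)) < M * R ^ (N + 1) * (c : ℝ) ^ (k * (N + 1)) := by
    calc (c : ℝ) ^ (N * (k + 1)) ≤ (A : ℝ) ^ N * (c' : ℝ) ^ N := h1
      _ < (A : ℝ) ^ N * (C ^ N * R' ^ (N + 1)) := mul_lt_mul_of_pos_left h2 (by positivity)
      _ ≤ (A : ℝ) ^ N * (C ^ N * ((K : ℝ) ^ (N + 1) * R ^ (N + 1) * (c : ℝ) ^ (k * (N + 1)))) :=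
          mul_le_mul_of_nonneg_left (mul_le_mul_of_nonneg_left h3 (by positivity)) (by positivity)
      _ = M * R ^ (N + 1) * (c : ℝ) ^ (k * (N + 1)) := by rw [hM]; ring
  -- cancel c^{k(N+1)} : N(k+1) = k(N+1) + n
  have h5 : (c : ℝ) ^ n < M * R ^ (N + 1) := by
    have hsplit : (c : ℝ) ^ (N * (k + 1)) = (c : ℝ) ^ n * (c : ℝ) ^ (k * (N + 1)) := by
      rw [← pow_add]; congr 1; rw [hN]; ring
    rw [hsplit] at h4
    exact lt_of_mul_lt_mul_right h4 (by positivity)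
  -- take n-th roots: c < M₁^{1/n} R^{(N+1)/n}
  have h6 : (c : ℝ) ^ n < (M₁ ^ ((n : ℝ)⁻¹) * R ^ (((N : ℝ) + 1) / n)) ^ n := by
    have hn0' : (n : ℝ) ≠ 0 := by exact_mod_cast hn0.ne'
    have hcast : ((N : ℝ) + 1) = ((N + 1 : ℕ) : ℝ) := by push_cast; ring
    rw [mul_pow, Real.rpow_inv_natCast_pow (by positivity) hn0.ne', ← Real.rpow_natCast (R ^ _) n,
      ← Real.rpow_mul hR0, div_mul_cancel₀ _ hn0', hcast, Real.rpow_natCast]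
    exact h5.trans_le (mul_le_mul_of_nonneg_right hMM₁ (by positivity))
  have h7 : (c : ℝ) < M₁ ^ ((n : ℝ)⁻¹) * R ^ (((N : ℝ) + 1) / n) :=
    lt_of_pow_lt_pow_left₀ n (by positivity) h6
  -- (N+1)/n ≤ 1 + ε₀ and R ≥ 1
  have h8 : ((N : ℝ) + 1) / n ≤ 1 + ε₀ := by
    rw [div_le_iff₀ (by exact_mod_cast hn0 : (0 : ℝ) < n), hN]
    push_cast
    nlinarith
  calc (c : ℝ) < M₁ ^ ((n : ℝ)⁻¹) * R ^ (((N : ℝ) + 1) / n) := h7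
    _ ≤ M₁ ^ ((n : ℝ)⁻¹) * R ^ (1 + ε₀) :=
        mul_le_mul_of_nonneg_left (Real.rpow_le_rpow_of_exponent_le hR1 h8) (by positivity)

/-! ## §3  Arithmetic helpers -/

/-- The members of an abc triple are nonzero and `a < c`, `b < c`. -/
private theorem triple_facts {a b c : ℕ} (ht : IsABCTriple a b c) :
    a ≠ 0 ∧ b ≠ 0 ∧ c ≠ 0 ∧ a < c ∧ b < c := by
  obtain ⟨ha, hb, habc, _⟩ := ht
  omega

/-- `radical (m * n) ≤ radical m * radical n`. -/
private theorem radical_mul_le (m n : ℕ) : radical (m * n) ≤ radical m * radical n :=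
  Nat.le_of_dvd (Nat.mul_pos (Nat.radical_pos _) (Nat.radical_pos _)) radical_mul_dvd

/-- `radical n ≤ n` for `0 < n`. -/
private theorem radical_le_self {n : ℕ} (hn : 0 < n) : radical n ≤ n := Nat.le_of_dvd hn radical_dvd_self

/-- `radical (m * n) ≤ radical m * n` for `0 < n`. -/
private theorem radical_mul_le_mul_self (m : ℕ) {n : ℕ} (hn : 0 < n) : radical (m * n) ≤ radical m * n :=
  (radical_mul_le m n).trans (Nat.mul_le_mul_left _ (radical_le_self hn))

/-- For a coprime triple, `rad(abc) = rad a · rad b · rad c`. -/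
private theorem rad_eq_prod {a b c : ℕ} (ht : IsABCTriple a b c) : rad a b c = radical a * radical b * radical c := by
  obtain ⟨ha, hb, habc, hcop⟩ := ht
  have hac : Nat.Coprime a c := by rw [← habc]; exact Nat.coprime_self_add_right.mpr hcop
  have hbc : Nat.Coprime b c := by rw [← habc]; exact Nat.coprime_add_self_right.mpr hcop.symm
  rw [rad_def, radical_mul (Nat.coprime_iff_isRelPrime.mp (Nat.Coprime.mul_left hac hbc)),
    radical_mul (Nat.coprime_iff_isRelPrime.mp hcop)]

/-- Every multiplicity is admissible at the member `1`. -/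
theorem adm_one (p : ℕ) : Adm p 1 := ⟨fun _ => rfl, fun ℓ hℓ => by simp at hℓ⟩

/-- A perfect `k`-th power is `k`-full. -/
theorem adm_pow {k x : ℕ} (hk : k ≠ 0) (hx : x ≠ 0) : Adm k (x ^ k) := by
  refine ⟨fun h => absurd h hk, fun ℓ hℓ => ?_⟩
  rw [Nat.primeFactors_pow _ hk] at hℓ
  obtain ⟨hℓp, hℓx, -⟩ := Nat.mem_primeFactors.1 hℓ
  rw [Nat.factorization_pow, Finsupp.smul_apply, smul_eq_mul]
  exact Nat.le_mul_of_pos_right k (hℓp.factorization_pos_of_dvd hx hℓx)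

/-- `k`-fullness from a `k`-th power divisor carrying every prime. -/
theorem adm_of_pow_dvd {k n m : ℕ} (hk : k ≠ 0) (hm : m ≠ 0) (hdvd : n ^ k ∣ m)
    (hprimes : ∀ ℓ : ℕ, ℓ.Prime → ℓ ∣ m → ℓ ∣ n) : Adm k m := by
  refine ⟨fun h => absurd h hk, fun ℓ hℓ => ?_⟩
  obtain ⟨hℓp, hℓm, -⟩ := Nat.mem_primeFactors.1 hℓ
  have : ℓ ^ k ∣ m := (pow_dvd_pow_of_dvd (hprimes ℓ hℓp hℓm) k).trans hdvd
  exact (hℓp.pow_dvd_iff_le_factorization hm).mp this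

/-- Admissibility is downward monotone in a nonzero multiplicity: `Adm p x`, `p' ≤ p`, `p' ≠ 0` give `Adm p' x`. -/
theorem adm_mono {p p' x : ℕ} (h : Adm p x) (hp' : p' ≠ 0) (hle : p' ≤ p) : Adm p' x :=
  ⟨fun h0 => absurd h0 hp', fun ℓ hℓ => hle.trans (h.2 ℓ hℓ)⟩

/-- The prime divisors of `108 = 2² · 3³` are `2` and `3`. -/
private theorem prime_dvd_108 {ℓ : ℕ} (hℓ : ℓ.Prime) (h : ℓ ∣ 108) : ℓ = 2 ∨ ℓ = 3 := by
  have h' : ℓ ∣ 2 ^ 2 * 3 ^ 3 := by norm_num at h ⊢; exact h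
  rcases (Nat.Prime.dvd_mul hℓ).mp h' with h2 | h3
  · exact Or.inl ((Nat.prime_dvd_prime_iff_eq hℓ Nat.prime_two).mp (hℓ.dvd_of_dvd_pow h2))
  · exact Or.inr ((Nat.prime_dvd_prime_iff_eq hℓ Nat.prime_three).mp (hℓ.dvd_of_dvd_pow h3))

end Summit.ABC.ABC.Theorems.PlatonicClosureCore
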